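import Summits.AtomisticToContinuum.Crystallization.Theorems.AveragedTwelve.Negative.LoadBearing

/-!
# `AveragedTwelve` (crux stmt-AtomisticToContinuum-15806), negative side IV:
# the pointwise excess reaches +4 at ratio 57/50 (sixteen neighbours of one centre)

`Negative/LoadBearing.lean` showed that the POINTWISE form of the crux (≤ 12 ρ-neighbours per centre) fails
at 57/50 with a 14-neighbour centre.  Here the per-centre cap is pushed to its true value at this ratio:
* `not_pointwise_of_intConfig k`: integer reduction — a `√D`-separated integer configuration with a centre
  having more than `k` others within `M ≤ c·√D` refutes "every centre has ≤ k ρ-neighbours" at ratio `c`;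
* `not_averagedTwelve_pointwise15`: at `c = 57/50` a centre with SIXTEEN ρ-neighbours exists (the Tammes-16
  configuration, min-chord ratio 1.13577 < 57/50, scale 1000, integer-rounded and kernel-checked: 17 points,
  all squared distances ≥ 998349, sixteen within 1139² of the centre, `2500·1139² ≤ 3249·998349`).
So the per-site excess `deg − 12` that any averaging argument must absorb is as large as +4 at this ratio
(seventeen neighbours would need the Tammes-17 radius ≈ 1.1589 > 1.14, which is only known numerically —
no cap below 17…19 is a theorem in print at 57/50).  This file does NOT refute the crux.  All `[folklore]`.
-/

namespace Summit.AtomisticToContinuum.Crystallization.Theorems.AveragedTwelveNegative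

open scoped BigOperators

/-- REFUTATION SHAPE for pointwise caps.  An integer configuration with pairwise squared distances `≥ D > 0`,
`0 ≤ M ≤ c·√D`, and a site `i0` with more than `k` others within squared distance `M²` refutes "every site has
at most `k` neighbours within `ρ`" at ratio constant `c`. [folklore] -/
theorem not_pointwise_of_intConfig (c : ℝ) (k : ℕ) {n : ℕ} (W : Fin n → Fin 3 → ℤ) (D M : ℤ)
    (hD : 0 < D) (hM : 0 ≤ M) (hcM : (M : ℝ) ≤ c * Real.sqrt D)
    (hsep : ∀ i j : Fin n, i ≠ j →
      D ≤ (W i 0 - W j 0) ^ 2 + (W i 1 - W j 1) ^ 2 + (W i 2 - W j 2) ^ 2)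
    (i0 : Fin n)
    (hcount : k < (Finset.univ.filter fun j : Fin n => j ≠ i0 ∧
        (W i0 0 - W j 0) ^ 2 + (W i0 1 - W j 1) ^ 2 + (W i0 2 - W j 2) ^ 2 ≤ M ^ 2).card) :
    ¬ (∀ (N : ℕ) (x : Fin N → EuclideanSpace ℝ (Fin 3)) (G : Finset (Fin N)) (d ρ : ℝ),
        0 < d → ρ ≤ c * d → (∀ i ∈ G, ∀ j ∈ G, i ≠ j → d ≤ dist (x i) (x j)) →
        ∀ i ∈ G, ((G.filter fun j => j ≠ i ∧ dist (x i) (x j) ≤ ρ).card) ≤ k) := by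
  intro H
  set X : Fin n → EuclideanSpace ℝ (Fin 3) :=
    fun k => (WithLp.toLp 2 ![((W k 0 : ℤ) : ℝ), ((W k 1 : ℤ) : ℝ), ((W k 2 : ℤ) : ℝ)] : EuclideanSpace ℝ (Fin 3))
    with hX
  have hsep' : ∀ i ∈ (Finset.univ : Finset (Fin n)), ∀ j ∈ (Finset.univ : Finset (Fin n)), i ≠ j →
      Real.sqrt D ≤ dist (X i) (X j) :=
    fun i _ j _ hij => (sqrt_le_dist_intPt_iff (W i) (W j) D).mpr (hsep i j hij)
  have h := H n X Finset.univ (Real.sqrt D) M (Real.sqrt_pos.mpr (by exact_mod_cast hD)) hcM hsep'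
    i0 (Finset.mem_univ _)
  have hdeg : ((Finset.univ : Finset (Fin n)).filter fun j => j ≠ i0 ∧ dist (X i0) (X j) ≤ (M : ℝ))
      = (Finset.univ.filter fun j : Fin n => j ≠ i0 ∧
          (W i0 0 - W j 0) ^ 2 + (W i0 1 - W j 1) ^ 2 + (W i0 2 - W j 2) ^ 2 ≤ M ^ 2) :=
    Finset.filter_congr (fun j _ => by rw [dist_intPt_le_iff (W i0) (W j) M hM])
  rw [hdeg] at h
  omega

/-- SIXTEEN ρ-NEIGHBOURS OF ONE CENTRE at ratio 57/50: the pointwise cap "≤ 15 per centre" is FALSE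
(a fortiori ≤ 12, 13, 14).  Witness (in the proof): the centre `(0,0,0)` and the sixteen points of the numerically
optimal Tammes-16 arrangement at radius ≈ 1135.8 (minimum chord ≈ 999.2; scale 1000), integer-rounded; all
squared distances ≥ 998349 and all sixteen satellites within `1139² ≤ (57/50)²·998349` of the centre (kernel
`decide`).  The per-site excess `deg − 12` reaches +4 at this ratio. [folklore] -/
theorem not_averagedTwelve_pointwise15 :
    ¬ (∀ (N : ℕ) (x : Fin N → EuclideanSpace ℝ (Fin 3)) (G : Finset (Fin N)) (d ρ : ℝ),
        0 < d → ρ ≤ 57 / 50 * d → (∀ i ∈ G, ∀ j ∈ G, i ≠ j → d ≤ dist (x i) (x j)) →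
        ∀ i ∈ G, ((G.filter fun j => j ≠ i ∧ dist (x i) (x j) ≤ ρ).card) ≤ 15) := by
  obtain ⟨W, hW⟩ : ∃ W : Fin 17 → Fin 3 → ℤ, W =
      ![![0, 0, 0], ![-390, -1026, 291], ![166, -986, -540], ![-1054, -404, -122], ![600, -896, 357],
        ![-499, -363, -953], ![-747, -254, 817], ![1086, -245, -226], ![-867, 478, -556], ![219, -308, 1071],
        ![479, -164, -1017], ![-818, 663, 425], ![914, 255, 624], ![48, 727, -872], ![52, 666, 919],
        ![837, 724, -257], ![-26, 1135, 38]] := ⟨_, rfl⟩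
  have hsep : ∀ i j : Fin 17, i ≠ j →
      (998349 : ℤ) ≤ (W i 0 - W j 0) ^ 2 + (W i 1 - W j 1) ^ 2 + (W i 2 - W j 2) ^ 2 := by
    subst hW; decide
  have hcount : 15 < (Finset.univ.filter fun j : Fin 17 => j ≠ 0 ∧
      (W 0 0 - W j 0) ^ 2 + (W 0 1 - W j 1) ^ 2 + (W 0 2 - W j 2) ^ 2 ≤ (1139 : ℤ) ^ 2).card := by
    subst hW; decide
  have hcM : ((1139 : ℤ) : ℝ) ≤ 57 / 50 * Real.sqrt ((998349 : ℤ) : ℝ) := by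
    have h1 : ((56950 : ℝ) / 57) ≤ Real.sqrt 998349 := (Real.le_sqrt' (by norm_num)).mpr (by norm_num)
    push_cast
    linarith
  exact not_pointwise_of_intConfig (57 / 50) 15 W 998349 1139 (by norm_num) (by norm_num) hcM hsep 0 hcount

end Summit.AtomisticToContinuum.Crystallization.Theorems.AveragedTwelveNegative
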